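import Literature.MathematicalPhysics.QuantumFieldTheory.Balaban1983to89.B12Display286RightMember
import Literature.MathematicalPhysics.QuantumFieldTheory.Balaban1983to89.B11Ineq190Actual

/-!
# `Balaban1983to89.B12KernelBound422From190` — T. Bałaban, *Renormalization group approach to lattice gauge field theories. I*,
# Commun. Math. Phys. **109** (1987) 249–301 [Balaban1987RG1] = [I], §4 pp. 282/286: the two (190)-SHAPE FIRST-ORDER LOCALISATION
# BOUNDS of p. 282 behind **(4.22)** DISCHARGED FROM [15] SECT. G — p07's E₀-free closing theorem
# `B12Display286RightMember.kernelBound422_closed_lattice_maxE₀` ((4.22) `KernelBound422Printed`, NE9 NEED-1 decl of record, for the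
# ACTUAL second sum of (4.21)) with its hypotheses `hlocx`, `hlocx₃` SUPPLIED BY NAME from r08's `B11Ineq190Actual.ineq190_sectG`
# ((190) for the actual Fréchet derivative of the [15] (179) chart) through pv12's `B12Ineq45.loc_dH_le_of_ineq190_localised` on a
# lattice presentation restricted to the localization domain `X`

statement-level skeleton of published theorems with citation tags; proofs where landed; nothing here is a claim
about the Yang–Mills mass gap

CITATION HEADER (lean-in-tree rule 2026-08-18).  T. Bałaban, *Renormalization group approach to lattice gauge field theories.
I. Generation of effective actions in a small field approximation and a coupling constant renormalization in four dimensions*,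
Commun. Math. Phys. **109**, 249–301 (1987), doi:10.1007/BF01215223, bib `Balaban1987RG1` (cell paper B12 = "[I]"; PDF held
`paper:balaban1987-cmp109-rg-i-small-field`, pp. 282, 286 = PDF 34, 38; renders `b2b-balaban-ref1/pages/1987-cmp109-rg-I-small-field/
…-p034-x2.png`, `…-p038-x2.png`).  "[15]" = T. Bałaban, *The variational problem and background fields in renormalization group method
for lattice gauge theories*, Commun. Math. Phys. **102**, 277–309 (1985), bib `Balaban1985Variational` (cell paper B11; Prop. 9 p. 309,
(190) p. 308, (179)–(180) p. 306).  "[3]" of [15] = T. Bałaban, *Propagators and renormalization transformations for lattice gauge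
theories. II*, Commun. Math. Phys. **96** (1984) 223–250, bib `Balaban1984PropagatorsII` (Lemma 2.1 (2.61) p. 234).  Mega-formalization
`lit-balaban`, HOME `run/shared/lean/pub/lit-balaban/`, unit `lit-balaban-r20` gen 13 (B12 fold owner; file of record for (4.22) =
`B12Sect4Statements`, p239748).

WHAT IS REPRODUCED.  SKELETON rows **B12.Eq4.21-4.22** ((4.22), head `proved p312125 + …`, r20/r09) and **B12.Eq4.5** / p. 282 (the
first-order localisation sentence).  THE PRINT, p. 282 [PDF 34] lines 5–9, verbatim (v1.2: the v1/v1.1 header carried a paraphrase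
marked as a quotation — referee ref-5 L-g37 (a); corrected here, mathematics unaffected): *"The derivative has an exponential decay in
a length of a shortest tree graph of this type. The norm in (4.4) of the expression ⟨(δ^{n(p)}/δB^{n(p)})𝐇_j(□₀, 0), ⊗_{i∈N(p)}B_i⟩
can be estimated by B₃Π_{i∈N(p)}|B_i|, and if one of the functions B_i is localized outside the domain X, then we have the additional
exponential factor exp(−δ₀dist^{(ξ)}(X, supp B_i))."* (glosses, NOT print: B₃ is the constant of the Sect. G [15] estimates; in
(4.5) the localized argument is B_i = (1 − ζ̃_□)B; dist^{(ξ)} = the distance in the ξ-scale); p. 286 [PDF 38]: *"Summing over x, x₃ we get finally the following estimate |(the second sum in (4.21))| ≦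
(32B₃(α₁/α₂)c₀(δ₁)c₁(δ₁))⁴ exp(−⅓κd_j(X))(Lʲη)⁵, (4.22)"*.  [15] (190) p. 308 / Prop. 9 p. 309: *"… its functional derivative (182)
satisfies the inequalities (190)."*

THE CHAIN, BY NAME (nothing restated, nothing modified).  p07 g10's `kernelBound422_closed_lattice_maxE₀` (p312125; composing r20
g11 `B12Term286DifferentBlocks`, p05 g9 `B12Term286SameBlock`, p07 `B12Display286RightMember` §§1–7) concludes (4.22)
`KernelBound422Printed ⟨‖Σ_{x,x₃}D⁴(𝐄∘𝐇)(0)[δB(x),B,B,(∂B)(Γ_{x,x₃})]‖, B₃, α₁, α₂, max{1,E₀}e^{6dMδ₁}K₁(d,δ₁), (2/δ₁)K₁(d,δ₁/2), κ,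
d_j(X), Lʲη⟩` for an abstract analytic inner map `H : W → E` (= 𝐇_j(□₀,·)) from "printed inputs only", among which the TWO (190)-SHAPE
FIRST-ORDER BOUNDS `hlocx`/`hlocx₃`: *‖D𝐇(y)[B_i]‖ ≤ e^{−δ₀ dist(X, supp B_i)}·K·‖B_i‖* for the point-localised arguments `B_i = δB(x)`
and `B_i = (∂B)(Γ_{x,x₃})` at every `y` of the analyticity ball — the p. 282 sentence, i.e. [15] (190) + one row sum.  pv12's
`B12Ineq45.loc_dH_le_of_ineq190_localised` proves that sentence in the block vocabulary of `B11SectG` from an ABSTRACT (190)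
record `h190`; r08 g10's `B11Ineq190Actual.ineq190_sectG` PRODUCES (190) for the ACTUAL Fréchet derivative of the (179) chart
`𝓗 = chartH179 𝒢 W D2 H₀ (· − H(D ·)) ε₄` at every point of the domain of (180) from the located leaves of [15] Sect. G only
(r08 `B11Eq183Differentiation.analyticOnNhd_chartH179`: 𝓗 analytic there; p29 `B11Presentation190.chartH179_zero`: 𝓗(0) = 0).
THIS FILE takes `H := (x ↦ ev_x) ∘ 𝓗` — the chart PRESENTED on the lattice points of `X` (print's 𝐄^{(j)}(X,·) depends on the
configuration on `X` only, (1.7)/(1.18)) — and DERIVES `hlocx`/`hlocx₃` for it, so that in (4.22) for the actual expansion the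
(190) record is no longer a hypothesis.

WHAT THIS FILE PROVES (kernel-checked, zero `sorry`; theorems only — no `def`, no new `Prop`, no named fact; axioms standard).
§1 `hasFDerivAt_presented_chartH179` / `norm_fderiv_presented_le_sectG` — THE p. 282 FIRST-ORDER SENTENCE FOR THE ACTUAL
   DERIVATIVE, as a NORM bound on the presented space `Xp → E₀` (sup norm over the lattice points `Xp` of `X`): for `δB` localised at
   ξ-distance `≥ Dst` from the blocks `Xbl` of `X` and `y` in the domain of (180),
   `‖D((ev∘𝓗))(y)[δB]‖ ≤ e^{−τ·Dst}·(const190·κ_B·c·‖δB‖)` — (190) by name (r08), the row sum at rate `σ`, `σ + τ ≤ ⅛δ₀^{[15]}`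
   (GAPS G-IF-06), the presentation/compatibility letters `hev` (*"for x ∈ Δ(y)"*), `hcover` (every point of `X` lies in the box of a
   block of `X`), `hBn` (local B-size ≤ norm).
§2 `kernelBound422_closed_lattice_sectG` — **(4.22) `KernelBound422Printed` FOR THE ACTUAL SECOND SUM OF (4.21) WITH THE INNER MAP
   THE PRESENTED [15] CHART AND `hlocx`/`hlocx₃` DISCHARGED**: p07's `kernelBound422_closed_lattice_maxE₀` with `W := 𝒳`,
   `E := Xp → E₀`, `H := (x ↦ ev_x) ∘ 𝓗`, `UW :=` the domain of (180) (`isOpen_dom180`), `𝓗(0) = 0` by `chartH179_zero`,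
   analyticity by `analyticOnNhd_chartH179`, `K := const190·κ_B·c`; every other hypothesis of p07's theorem verbatim.
§3 (v1.1) `ineq45_presented_sectG` — **(4.5)** (row B12.Eq4.5) FOR THE ACTUAL DERIVATIVE OF THE PRESENTED CHART: p05 g8's generic
   `B12Eq45LocalisedBlocks.norm_iteratedFDeriv_comp_le_of_loc` ((4.5) with every block hypothesis discharged, inner map abstract with
   the (190)-shape letter `hloc`) at `H := (x ↦ ev_x) ∘ 𝓗`, `hloc` := §1 for the arguments `B_i = (1 − ζ̃_□)B` localised at ξ-distance
   `≥ Dst` from `X`, `W₀ := e^{−τ·Dst}`.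
HONEST SCOPE.  Assembly of landed theorems BY NAME: p07 `B12Display286RightMember` (p312125), pv12 `B12Ineq45`, r08
`B11Ineq190Actual` (p304614) / `B11Eq183Differentiation` (p299972), p29 `B11Presentation190` (p303950).  What is LEFT as hypothesis
in §§2–3, exactly: (i) r08's located leaves of [15] Sect. G — `Regime 𝒢 0 W B₀ θ C₄ a₃ j a ε₄`, `W` analytic on `‖Y‖ < a₃`, the Sect. C map
`Y ↦ Y − H(D Y)` analytic on `‖Y‖ < ε₄ + a` and `= 0` at `0`, (189) `h189` and (73) `hDfr` at the points of the domain (G-B11-G2), the kernel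
letters `hG`/`hD2H0`/`hH0`/`hH`, (2.54) `htri`/`hd`, `q < 1` (`hq`), compatibility `hN`/`hBloc`/`hBn`; (ii) the presentation letters `hev`,
`hcover`, and `hballW` (the analyticity ball `‖B‖ < a_W` of p07's Cauchy estimate lies in the domain of (180) — two operator-norm
inequalities on H₀, Δ⁽²⁾H₀, kept as a letter), the sup bound `hSH` of [15] Prop. 9 on that ball (as in p07); (iii) p07's own printed inputs
verbatim — (4.4)+(1.18) for the outer function `f` (= A ↦ 𝐄^{(j)}(X, exp iξA) on the presented space), the sizes (4.17)/p. 277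
(`hB0…hB3`, `hnormB'`, `hδB'`, `hdBΓ'`), the lattice geometry (`X` a localization domain of the window, `x₀ ∈ X`, the point functions of
`D` the lattice ones), `0 < δ₁ ≤ 2`, `4dδ₁ ≤ δ₀^{(286)}`, `3dMδ₁ ≤ κ`, `α₂ ≤ 8B₃`, and the weight `max{S_H, K}·max{1,8/a_W}⁴ ≤ B₃`; (iv) the
LOCALISATION of the two point fields in the block geometry: `δB(x)` (slot 0) is supported in blocks at ξ-distance `≥ dist^{(ξ)}(X,x)`
from the blocks of `X`, `(∂B)(Γ_{x,x₃})`-slot 3 at distance `≥ dist^{(ξ)}(X,x₃)` (`hloc0`, `hloc3`; print: *"B_i is localized outside the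
domain X … dist(X, supp B_i)"*), with the rate identification `D.δ₀ = τ`.  The same-block family still enters by p05's half-rate Cauchy
route (G-B11-G2a untouched; not needed); the display slack `e^{6dMδ₁}` sits in `c₀` (G-B12-06) — both exactly as in p07's theorem.  No
lattice object of [15] is constructed (the instantiation of `𝒴` as the space (115) on `T_η` is the presentation datum `ev`).  NOT summit
progress.  r20 gen 13 (literature-prover-lit-balaban-r20-g13-0).
-/

noncomputable section

open Set Metric Finset
open scoped BigOperators

namespace Literature.MathematicalPhysics.QuantumFieldTheory.Balaban1983to89.B12KernelBound422From190

open Literature.MathematicalPhysics.QuantumFieldTheory.Balaban1983to89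
open B11SectG B11Eq174Chart B11Eq183Differentiation B11Presentation190 B11Ineq190Actual B12Ineq45
  B12Sect4Statements B12Sec2to5 B13ScaleTransfer TreeLength TreeLengthCubeSystem B12Decay510Lattice B12Decay510Window
  B12Display286RightMember B6RandomWalk

/-- The (190) constant `const190 …` of `B11SectG` is `≥ 0` for non-negative data under `q < 1` (private copy of p29's
`B16Ineq123From190.const190_nonneg`, to keep the import cone inside B11/B12). [cite: Balaban1985Variational, (187)–(190) p.308] -/
private theorem const190_nonneg' {κB κN κ₃ BG θW cΔ A₀ AH θD c : ℝ} (hκB : 0 ≤ κB) (hκN : 0 ≤ κN) (hκ₃ : 0 ≤ κ₃)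
    (hc : 0 ≤ c) (hBG : 0 ≤ BG) (hθW : 0 ≤ θW) (hcΔ : 0 ≤ cΔ) (hA₀ : 0 ≤ A₀) (hAH : 0 ≤ AH) (hθD : 0 ≤ θD)
    (hq : qG κ₃ κN BG θW c < 1) : 0 ≤ const190 κB κN κ₃ BG θW cΔ A₀ AH θD c := by
  unfold const190
  have h₁ := constA0_nonneg (cΔ := cΔ) hκ₃ hκN hBG hθW hcΔ hA₀ hc hq
  positivity

variable {𝒳 𝒴 𝒵 : Type} [NormedAddCommGroup 𝒳] [NormedSpace ℂ 𝒳] [NormedAddCommGroup 𝒴] [NormedSpace ℂ 𝒴]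
  [NormedAddCommGroup 𝒵] [NormedSpace ℂ 𝒵] [CompleteSpace 𝒳] [CompleteSpace 𝒴] [CompleteSpace 𝒵]
  {𝒢 : 𝒵 →L[ℂ] 𝒴} {W : 𝒴 → 𝒵} {D2 : 𝒴 →L[ℂ] 𝒵} {H₀ : 𝒳 →L[ℂ] 𝒴} {B₀ θ C₄ a₃ j a ε₄ : ℝ}
  {g : B6.Geometry}
  {Xp : Type} [Fintype Xp] {E₀ : Type} [NormedAddCommGroup E₀] [NormedSpace ℂ E₀]

/-! ## §1 The p. 282 first-order localisation sentence for the actual derivative, on the presented space -/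

/-- **The presented chart is differentiable with the presented derivative**: for `𝓗 = chartH179 …` analytic at the points of the domain of
(180) (r08 `analyticOnNhd_chartH179`) and the linear presentation `x ↦ ev_x` (lattice values of a configuration, print's (115)/(190)
being statements *"for x ∈ Δ(y)"*), the map `B ↦ (x ↦ ev_x(𝓗(B)))` into `Xp → E₀` has Fréchet derivative `δB ↦ (x ↦ ev_x(D𝓗(y)δB))`
at every `y` of the domain. [cite: Balaban1985Variational, Prop. 9 p.309, (179)–(180) p.306] -/
theorem hasFDerivAt_presented_chartH179 (R : Regime 𝒢 0 W B₀ θ C₄ a₃ j a ε₄) (hWa : AnalyticOnNhd ℂ W {Y : 𝒴 | ‖Y‖ < a₃})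
    {D : 𝒴 → 𝒳} (H : 𝒳 →L[ℂ] 𝒴) (hTm : AnalyticOnNhd ℂ (fun Y : 𝒴 => Y - H (D Y)) {Y : 𝒴 | ‖Y‖ < ε₄ + a})
    (ev : Xp → (𝒴 →L[ℂ] E₀)) {y : 𝒳} (hy : ‖H₀ y‖ < a ∧ ‖D2 (H₀ y)‖ < j) :
    HasFDerivAt (fun B : 𝒳 => fun x : Xp => ev x (chartH179 𝒢 W D2 H₀ (fun Y : 𝒴 => Y - H (D Y)) ε₄ B))
      ((ContinuousLinearMap.pi ev).comp (fderiv ℂ (chartH179 𝒢 W D2 H₀ (fun Y : 𝒴 => Y - H (D Y)) ε₄) y)) y := by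
  have hdiff : DifferentiableAt ℂ (chartH179 𝒢 W D2 H₀ (fun Y : 𝒴 => Y - H (D Y)) ε₄) y :=
    ((analyticOnNhd_chartH179 R hWa hTm) y hy).differentiableAt
  exact (ContinuousLinearMap.pi ev).hasFDerivAt.comp y hdiff.hasFDerivAt

/-- **THE p. 282 SENTENCE FOR THE ACTUAL DERIVATIVE, NORM FORM ON THE PRESENTED SPACE** (*"If a configuration B_i is localized
outside the domain X … then we have an additional exponential factor exp(−δ₀ dist(X, supp B_i))"*, with *"B₃ … a constant from
these estimates"* = [15] (190)): for `y` in the domain of (180), a field `δB` whose B-sizes vanish on every block `y′` closer than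
`Dst` to a block of `X` (`hlocδ`), under r08's located leaves of [15] Sect. G (so that (190) HOLDS for `D𝓗(y)`,
`B11Ineq190Actual.ineq190_sectG`), ONE row sum at rate `σ` with `σ + τ ≤ ⅛δ₀^{[15]}`, and the presentation letters (`hev`: the values at
the points of the box of a block are dominated by the N-size there; `hcover`: every lattice point of `X` lies in the box of a block of
`X`; `hBn`: local B-size ≤ norm):
`‖D(ev∘𝓗)(y)[δB]‖_{sup over Xp} ≤ e^{−τ·Dst}·(const190·κ_B·c·‖δB‖)` — pv12's `B12Ineq45.loc_dH_le_of_ineq190_localised` with `h190`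
DISCHARGED. [cite: Balaban1987RG1, p.282] [cite: Balaban1985Variational, Prop. 9 (190) pp.308–309]
[cite: Balaban1984PropagatorsII, Lemma 2.1 (2.61) p.234] -/
theorem norm_fderiv_presented_le_sectG (R : Regime 𝒢 0 W B₀ θ C₄ a₃ j a ε₄) (hWa : AnalyticOnNhd ℂ W {Y : 𝒴 | ‖Y‖ < a₃})
    {Dm : 𝒴 → 𝒳} (H : 𝒳 →L[ℂ] 𝒴) (hTm : AnalyticOnNhd ℂ (fun Y : 𝒴 => Y - H (Dm Y)) {Y : 𝒴 | ‖Y‖ < ε₄ + a})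
    {bB : BlockNorm g 𝒳} {bN : BlockNorm g 𝒴} {b3 : BlockNorm g 𝒵}
    (hN : ∀ (y : g.Site) (v : 𝒴), bN.loc y v ≤ ‖v‖) (hBloc : ∀ (y' : g.Site) (μ : 𝒳), bB.IsLoc y' μ → ‖μ‖ ≤ bB.loc y' μ)
    (hBn : ∀ (y' : g.Site) (μ : 𝒳), bB.loc y' μ ≤ ‖μ‖)
    (ev : Xp → (𝒴 →L[ℂ] E₀)) {boxp : g.Site → Finset Xp} (Xbl : Set g.Site)
    (hev : ∀ (yb : g.Site) (v : 𝒴), ∀ x ∈ boxp yb, ‖ev x v‖ ≤ bN.loc yb v) (hcover : ∀ x : Xp, ∃ yb ∈ Xbl, x ∈ boxp yb)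
    {δ₀ BG θW cΔ A₀ AH θD c σ τ : ℝ}
    (htri : Triangle254 g) (hd : ∀ a b : g.Site, 0 ≤ g.dist a b) (hδ₀ : 0 ≤ δ₀) (hrow : RowSum g σ c) (hc : 0 ≤ c)
    (hτ : 0 ≤ τ) (hστ : σ + τ ≤ δ₀ / 8)
    (hBG : 0 ≤ BG) (hθW : 0 ≤ θW) (hcΔ : 0 ≤ cΔ) (hA₀ : 0 ≤ A₀) (hAH : 0 ≤ AH) (hθD : 0 ≤ θD)
    (hG : HasMaj b3 bN (𝒢.restrictScalars ℝ : 𝒵 →ₗ[ℝ] 𝒴) (fun y y' => BG * Real.exp (-(δ₀ * g.dist y y'))))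
    (hD2H0 : HasMaj bB b3 ((D2 ∘L H₀).restrictScalars ℝ : 𝒳 →ₗ[ℝ] 𝒵) (fun y y' => cΔ * Real.exp (-(δ₀ * g.dist y y'))))
    (hH0 : HasMaj bB bN (H₀.restrictScalars ℝ : 𝒳 →ₗ[ℝ] 𝒴) (fun y y' => A₀ * Real.exp (-(δ₀ * g.dist y y'))))
    (hH : HasMaj bB bN (H.restrictScalars ℝ : 𝒳 →ₗ[ℝ] 𝒴) (fun y y' => AH * Real.exp (-(δ₀ / 2 * g.dist y y'))))
    (h189 : ∀ B' : 𝒳, ‖H₀ B'‖ < a → ‖D2 (H₀ B')‖ < j →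
      Ineq189 bN b3 ((fderiv ℂ W (solA180 𝒢 W D2 H₀ ε₄ B' + H₀ B')).restrictScalars ℝ : 𝒴 →ₗ[ℝ] 𝒵) θW δ₀)
    (hDfr : ∀ B' : 𝒳, ‖H₀ B'‖ < a → ‖D2 (H₀ B')‖ < j →
      ∃ 𝔇 : 𝒴 →L[ℂ] 𝒳, HasFDerivAt Dm 𝔇 (solA180 𝒢 W D2 H₀ ε₄ B' + H₀ B') ∧
        HasMaj bN bB (𝔇.restrictScalars ℝ : 𝒴 →ₗ[ℝ] 𝒳) (fun y y' => θD * Real.exp (-(δ₀ / 2 * g.dist y y'))))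
    (hq : qG b3.κ bN.κ BG θW c < 1)
    {y : 𝒳} (hy : ‖H₀ y‖ < a ∧ ‖D2 (H₀ y)‖ < j) (δB : 𝒳) {Dst : ℝ}
    (hlocδ : ∀ yb ∈ Xbl, ∀ y', bB.loc y' δB ≠ 0 → Dst ≤ g.dist yb y') :
    ‖fderiv ℂ (fun B : 𝒳 => fun x : Xp => ev x (chartH179 𝒢 W D2 H₀ (fun Y : 𝒴 => Y - H (Dm Y)) ε₄ B)) y δB‖
      ≤ Real.exp (-(τ * Dst)) * (const190 bB.κ bN.κ b3.κ BG θW cΔ A₀ AH θD c * bB.κ * c * ‖δB‖) := by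
  rw [(hasFDerivAt_presented_chartH179 R hWa H hTm ev hy).fderiv]
  obtain ⟨𝔇, hD𝔇, h𝔇⟩ := hDfr y hy.1 hy.2
  set Cst : ℝ := const190 bB.κ bN.κ b3.κ BG θW cΔ A₀ AH θD c with hCst
  set F := fderiv ℂ (chartH179 𝒢 W D2 H₀ (fun Y : 𝒴 => Y - H (Dm Y)) ε₄) y with hF
  have hσ : σ ≤ δ₀ / 8 := by linarith
  have h190 : Ineq190 bB bN (F.restrictScalars ℝ : 𝒳 →ₗ[ℝ] 𝒴) Cst δ₀ :=
    ineq190_sectG R hWa hy.2 hy.1 H hD𝔇 hN hBloc htri hd hδ₀ (hrow.mono hd hσ) hc hBG hθW hcΔ hA₀ hAH hθD hG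
      (h189 y hy.1 hy.2) hD2H0 hH0 hH h𝔇 hq
  have hC : 0 ≤ Cst := const190_nonneg' bB.κ_nonneg bN.κ_nonneg b3.κ_nonneg hc hBG hθW hcΔ hA₀ hAH hθD hq
  have hRHS : 0 ≤ Real.exp (-(τ * Dst)) * (Cst * bB.κ * c * ‖δB‖) :=
    mul_nonneg (Real.exp_nonneg _) (mul_nonneg (mul_nonneg (mul_nonneg hC bB.κ_nonneg) hc) (norm_nonneg _))
  refine (pi_norm_le_iff_of_nonneg hRHS).2 fun x => ?_
  obtain ⟨yb, hyb, hx⟩ := hcover x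
  have hval : ((ContinuousLinearMap.pi ev).comp F) δB x = ev x (F δB) := rfl
  rw [hval]
  have h1 := hev yb (F δB) x hx
  have h2 := loc_dH_le_of_ineq190_localised h190 hC hd hrow hτ hστ δB (fun y' => hBn y' δB) Xbl hlocδ hyb
  calc ‖ev x (F δB)‖ ≤ bN.loc yb (F δB) := h1
    _ ≤ Cst * bB.κ * c * ‖δB‖ * Real.exp (-(τ * Dst)) := by simpa using h2
    _ = Real.exp (-(τ * Dst)) * (Cst * bB.κ * c * ‖δB‖) := by ring

/-! ## §2 (4.22) for the actual second sum with the inner map the presented [15] chart, `hlocx`/`hlocx₃` discharged -/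

/-- **(4.22) `KernelBound422Printed` FOR THE ACTUAL SECOND SUM OF (4.21), THE INNER MAP BEING THE PRESENTED [15] (179) CHART
`𝐇_j(□₀,·) = (x ↦ ev_x) ∘ 𝓗`, WITH THE TWO (190)-SHAPE FIRST-ORDER BOUNDS DISCHARGED FROM [15] SECT. G.**  p07 g10's
`B12Display286RightMember.kernelBound422_closed_lattice_maxE₀` ((4.22) E₀-free: both partition families, the p. 286 right member,
the lattice sums `c₀ = max{1,E₀}e^{6dMδ₁}K₁(d,δ₁)`, `c₁ = (2/δ₁)K₁(d,δ₁/2)` derived) with: `W := 𝒳` (the B-space of the scheme),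
`E := Xp → E₀` (configurations on the lattice points of `X`, sup norm), `H := B ↦ (x ↦ ev_x(𝓗(B)))`, its analyticity domain the
domain of (180) (`isOpen_dom180`, `analyticOnNhd_chartH179`), `𝓗(0) = 0` (`chartH179_zero`), `K := const190·κ_B·c`, and
`hlocx`/`hlocx₃` := §1 for the point fields `δB(x)` (slot 0, localised at ξ-distance `≥ dist^{(ξ)}(X,x)` from the blocks of `X`) and
`(∂B)(Γ_{x,x₃})` (slot 3, `≥ dist^{(ξ)}(X,x₃)`), at the rate `D.δ₀ = τ`, `σ + τ ≤ ⅛δ₀^{[15]}`.  Every other input is p07's, verbatim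
((4.4)+(1.18) for the outer `f`, [15] Prop. 9 sup `hSH` on the Cauchy ball `‖B‖ < a_W` ⊆ domain (`hballW`), the sizes (4.17)/p. 277, the
lattice geometry with `x₀ ∈ X`, `0 < δ₁ ≤ 2`, `4dδ₁ ≤ δ₀`, `3dMδ₁ ≤ κ`, `α₂ ≤ 8B₃`, the weight `max{S_H,K}max{1,8/a_W}⁴ ≤ B₃`).
[cite: Balaban1987RG1, (4.22) p.286, p.282] [cite: Balaban1985Variational, Prop. 9 (190) pp.308–309]
[cite: Balaban1984PropagatorsII, Lemma 2.1 (2.61) p.234] -/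
theorem kernelBound422_closed_lattice_sectG {d M : ℕ} (hM : 0 < M) (Bw : Finset (Pt d)) (X : Dom Bw) {x₀ : Pt d}
    (hx₀ : cubeOf M x₀ ∈ X.1) (S : Finset (Pt d)) (D : PointData286 S)
    (hdjX : D.djX = treeLen X.1) (hdistX : ∀ x : S, D.distX x = (geomS Bw M).distD x.1 X)
    (hdist0 : ∀ x : S, D.dist0 x = l1 (x.1 - x₀)) (hlen : ∀ x x₃ : S, D.len x x₃ = l1 (x₃.1 - x.1))
    (hδ₁ : 0 < D.δ₁) (hδ₁2 : D.δ₁ ≤ 2) (h1 : 4 * d * D.δ₁ ≤ D.δ₀) (h2 : 3 * d * M * D.δ₁ ≤ D.κ) (hL : 0 ≤ D.Ljη)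
    -- the scheme of [15] Sect. G (r08) and its located leaves
    (R : Regime 𝒢 0 W B₀ θ C₄ a₃ j a ε₄) (hWa : AnalyticOnNhd ℂ W {Y : 𝒴 | ‖Y‖ < a₃})
    {Dm : 𝒴 → 𝒳} (H : 𝒳 →L[ℂ] 𝒴) (hTm : AnalyticOnNhd ℂ (fun Y : 𝒴 => Y - H (Dm Y)) {Y : 𝒴 | ‖Y‖ < ε₄ + a})
    (hTm0 : (0 : 𝒴) - H (Dm 0) = 0)
    {bB : BlockNorm g 𝒳} {bN : BlockNorm g 𝒴} {b3 : BlockNorm g 𝒵}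
    (hN : ∀ (y : g.Site) (v : 𝒴), bN.loc y v ≤ ‖v‖) (hBloc : ∀ (y' : g.Site) (μ : 𝒳), bB.IsLoc y' μ → ‖μ‖ ≤ bB.loc y' μ)
    (hBn : ∀ (y' : g.Site) (μ : 𝒳), bB.loc y' μ ≤ ‖μ‖)
    [CompleteSpace E₀] (ev : Xp → (𝒴 →L[ℂ] E₀)) {boxp : g.Site → Finset Xp} (Xbl : Set g.Site)
    (hev : ∀ (yb : g.Site) (v : 𝒴), ∀ x ∈ boxp yb, ‖ev x v‖ ≤ bN.loc yb v) (hcover : ∀ x : Xp, ∃ yb ∈ Xbl, x ∈ boxp yb)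
    {δ₀ BG θW cΔ A₀ AH θD c σ : ℝ}
    (htri : Triangle254 g) (hd : ∀ a b : g.Site, 0 ≤ g.dist a b) (hδ₀ : 0 ≤ δ₀) (hrow : RowSum g σ c) (hc : 0 ≤ c)
    (hτ : 0 ≤ D.δ₀) (hστ : σ + D.δ₀ ≤ δ₀ / 8)
    (hBG : 0 ≤ BG) (hθW : 0 ≤ θW) (hcΔ : 0 ≤ cΔ) (hA₀ : 0 ≤ A₀) (hAH : 0 ≤ AH) (hθD : 0 ≤ θD)
    (hG : HasMaj b3 bN (𝒢.restrictScalars ℝ : 𝒵 →ₗ[ℝ] 𝒴) (fun y y' => BG * Real.exp (-(δ₀ * g.dist y y'))))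
    (hD2H0 : HasMaj bB b3 ((D2 ∘L H₀).restrictScalars ℝ : 𝒳 →ₗ[ℝ] 𝒵) (fun y y' => cΔ * Real.exp (-(δ₀ * g.dist y y'))))
    (hH0 : HasMaj bB bN (H₀.restrictScalars ℝ : 𝒳 →ₗ[ℝ] 𝒴) (fun y y' => A₀ * Real.exp (-(δ₀ * g.dist y y'))))
    (hH : HasMaj bB bN (H.restrictScalars ℝ : 𝒳 →ₗ[ℝ] 𝒴) (fun y y' => AH * Real.exp (-(δ₀ / 2 * g.dist y y'))))
    (h189 : ∀ B' : 𝒳, ‖H₀ B'‖ < a → ‖D2 (H₀ B')‖ < j →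
      Ineq189 bN b3 ((fderiv ℂ W (solA180 𝒢 W D2 H₀ ε₄ B' + H₀ B')).restrictScalars ℝ : 𝒴 →ₗ[ℝ] 𝒵) θW δ₀)
    (hDfr : ∀ B' : 𝒳, ‖H₀ B'‖ < a → ‖D2 (H₀ B')‖ < j →
      ∃ 𝔇 : 𝒴 →L[ℂ] 𝒳, HasFDerivAt Dm 𝔇 (solA180 𝒢 W D2 H₀ ε₄ B' + H₀ B') ∧
        HasMaj bN bB (𝔇.restrictScalars ℝ : 𝒴 →ₗ[ℝ] 𝒳) (fun y y' => θD * Real.exp (-(δ₀ / 2 * g.dist y y'))))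
    (hq : qG b3.κ bN.κ BG θW c < 1)
    -- the outer function: (4.4) + (1.18) on the presented space
    {F : Type*} [NormedAddCommGroup F] [NormedSpace ℂ F] [CompleteSpace F]
    {U : Set (Xp → E₀)} (hU : IsOpen U) (hα : 0 < D.α₂) (hαB : D.α₂ ≤ 8 * D.B₃) (hball : ball (0 : Xp → E₀) D.α₂ ⊆ U)
    {f : (Xp → E₀) → F} (hf : AnalyticOnNhd ℂ f U)
    (hS : ∀ y ∈ ball (0 : Xp → E₀) D.α₂, ‖f y‖ ≤ D.E₀ * Real.exp (-(D.κ * D.djX)))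
    -- the Cauchy ball of the inner map inside the domain of (180), and [15] Prop. 9's sup bound there
    {aW SH : ℝ} (haW : 0 < aW) (hballW : ball (0 : 𝒳) aW ⊆ {B : 𝒳 | ‖H₀ B‖ < a ∧ ‖D2 (H₀ B)‖ < j})
    (hSH : ∀ y ∈ ball (0 : 𝒳) aW,
      ‖(fun x : Xp => ev x (chartH179 𝒢 W D2 H₀ (fun Y : 𝒴 => Y - H (Dm Y)) ε₄ y))‖ ≤ SH)
    -- the four fields of (4.21): δB(x), B, B, (∂B)(Γ_{x,x₃}), their sizes and localisations
    (Bf : S → S → Fin 4 → 𝒳) (hB0 : ∀ x x₃, ‖Bf x x₃ 0‖ ≤ D.δB x) (hB1 : ∀ x x₃, ‖Bf x x₃ 1‖ ≤ D.normB)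
    (hB2 : ∀ x x₃, ‖Bf x x₃ 2‖ ≤ D.normB) (hB3 : ∀ x x₃, ‖Bf x x₃ 3‖ ≤ D.dBΓ x x₃)
    (hloc0 : ∀ x x₃ : S, ∀ yb ∈ Xbl, ∀ y', bB.loc y' (Bf x x₃ 0) ≠ 0 → D.distX x ≤ g.dist yb y')
    (hloc3 : ∀ x x₃ : S, ∀ yb ∈ Xbl, ∀ y', bB.loc y' (Bf x x₃ 3) ≠ 0 → D.distX x₃ ≤ g.dist yb y')
    (hB₃ : max SH (const190 bB.κ bN.κ b3.κ BG θW cΔ A₀ AH θD c * bB.κ * c) * (max 1 (2 * (4 : ℝ) / aW)) ^ 4 ≤ D.B₃)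
    (hnormB : 0 ≤ D.normB) (hnormB' : D.normB ≤ D.α₁ * D.Ljη) (hδB' : ∀ x, D.δB x ≤ D.α₁ * D.Ljη)
    (hdBΓ' : ∀ x x₃, D.dBΓ x x₃ ≤ D.α₁ * D.Ljη ^ 2 * D.len x x₃) :
    KernelBound422Printed
      ⟨‖∑ x, ∑ x₃, iteratedFDeriv ℂ 4
          (f ∘ fun B : 𝒳 => fun x : Xp => ev x (chartH179 𝒢 W D2 H₀ (fun Y : 𝒴 => Y - H (Dm Y)) ε₄ B)) 0 (Bf x x₃)‖,
        D.B₃, D.α₁, D.α₂, max 1 D.E₀ * (Real.exp (6 * d * M * D.δ₁) * K₁ d D.δ₁), 2 / D.δ₁ * K₁ d (D.δ₁ / 2),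
        D.κ, D.djX, D.Ljη⟩ := by
  -- the analyticity domain of the presented chart = the domain of (180)
  have hUW : IsOpen {B : 𝒳 | ‖H₀ B‖ < a ∧ ‖D2 (H₀ B)‖ < j} := isOpen_dom180
  have h0dom : (0 : 𝒳) ∈ {B : 𝒳 | ‖H₀ B‖ < a ∧ ‖D2 (H₀ B)‖ < j} := hballW (mem_ball_self haW)
  have ha : 0 < a := by simpa using h0dom.1
  have hj : 0 ≤ j := by have := h0dom.2; simp at this; exact this.le
  have hHan : AnalyticOnNhd ℂ
      (fun B : 𝒳 => fun x : Xp => ev x (chartH179 𝒢 W D2 H₀ (fun Y : 𝒴 => Y - H (Dm Y)) ε₄ B))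
      {B : 𝒳 | ‖H₀ B‖ < a ∧ ‖D2 (H₀ B)‖ < j} := by
    intro B hB
    exact (ContinuousLinearMap.pi ev).analyticAt _ |>.comp ((analyticOnNhd_chartH179 R hWa hTm) B hB)
  have hHp0 : (fun B : 𝒳 => fun x : Xp => ev x (chartH179 𝒢 W D2 H₀ (fun Y : 𝒴 => Y - H (Dm Y)) ε₄ B)) 0 = 0 := by
    funext x
    simp only [Pi.zero_apply]
    rw [chartH179_zero R hj ha hTm0, map_zero]
  have hK : 0 ≤ const190 bB.κ bN.κ b3.κ BG θW cΔ A₀ AH θD c * bB.κ * c :=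
    mul_nonneg (mul_nonneg (const190_nonneg' bB.κ_nonneg bN.κ_nonneg b3.κ_nonneg hc hBG hθW hcΔ hA₀ hAH hθD hq)
      bB.κ_nonneg) hc
  -- the two (190)-shape first-order bounds, DISCHARGED (§1)
  have hlocx : ∀ x x₃ : S, ∀ y ∈ ball (0 : 𝒳) aW,
      ‖fderiv ℂ (fun B : 𝒳 => fun x : Xp => ev x (chartH179 𝒢 W D2 H₀ (fun Y : 𝒴 => Y - H (Dm Y)) ε₄ B)) y (Bf x x₃ 0)‖
        ≤ Real.exp (-(D.δ₀ * D.distX x)) * (const190 bB.κ bN.κ b3.κ BG θW cΔ A₀ AH θD c * bB.κ * c * ‖Bf x x₃ 0‖) :=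
    fun x x₃ y hy => norm_fderiv_presented_le_sectG R hWa H hTm hN hBloc hBn ev Xbl hev hcover htri hd hδ₀ hrow hc hτ hστ
      hBG hθW hcΔ hA₀ hAH hθD hG hD2H0 hH0 hH h189 hDfr hq (hballW hy) (Bf x x₃ 0) (hloc0 x x₃)
  have hlocx₃ : ∀ x x₃ : S, ∀ y ∈ ball (0 : 𝒳) aW,
      ‖fderiv ℂ (fun B : 𝒳 => fun x : Xp => ev x (chartH179 𝒢 W D2 H₀ (fun Y : 𝒴 => Y - H (Dm Y)) ε₄ B)) y (Bf x x₃ 3)‖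
        ≤ Real.exp (-(D.δ₀ * D.distX x₃)) * (const190 bB.κ bN.κ b3.κ BG θW cΔ A₀ AH θD c * bB.κ * c * ‖Bf x x₃ 3‖) :=
    fun x x₃ y hy => norm_fderiv_presented_le_sectG R hWa H hTm hN hBloc hBn ev Xbl hev hcover htri hd hδ₀ hrow hc hτ hστ
      hBG hθW hcΔ hA₀ hAH hθD hG hD2H0 hH0 hH h189 hDfr hq (hballW hy) (Bf x x₃ 3) (hloc3 x x₃)
  exact kernelBound422_closed_lattice_maxE₀ hM Bw X hx₀ S D hdjX hdistX hdist0 hlen hδ₁ hδ₁2 h1 h2 hL hU hα hαB hball hf hS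
    hUW haW hballW hHan hSH hHp0 hK Bf hB0 hB1 hB2 hB3 hlocx hlocx₃ hB₃ hnormB hnormB' hδB' hdBΓ'

/-! ## §3 (v1.1) (4.5) for the actual derivative on the presented space, the (190)-shape letter discharged -/

/-- **(4.5) `‖Dⁿ(𝐄∘𝐇)(0)[B₁,…,B_n]‖ ≤ (2n²B₃/α₂)ⁿ·S·W₀·Π‖B_i‖` FOR THE ACTUAL DERIVATIVE OF THE PRESENTED [15] CHART, THE p. 282
LOCALISATION LETTER DISCHARGED** (p. 282: *"Each term can be estimated by B₃Π|B_i| … If a configuration B_i is localized outside the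
domain X … we have an additional exponential factor exp(−δ₀dist(X, supp B_i))"*): p05 g8's generic `B12Eq45LocalisedBlocks.
norm_iteratedFDeriv_comp_le_of_loc` ((4.5) with every block hypothesis discharged, inner map abstract with the (190)-shape first-order
letter `hloc`) AT the presented chart `H := B ↦ (x ↦ ev_x(𝓗(B)))` into `Xp → E₀`, with `hloc` := §1 (`norm_fderiv_presented_le_sectG`,
r08's (190) by name) for the arguments `B_i`, `out i`, all localised at ξ-distance `≥ Dst ≥ 0` from the blocks of `X` (`hlocB`; print:
`B_i = (1 − ζ̃_□)B`, `Dst = dist^{(ξ)}(X, supp(1 − ζ̃_□))`), `W₀ := e^{−τ·Dst}`, `K := const190·κ_B·c`, `B₃ := max{S_H,K}·max{1,2n/a_W}ⁿ`;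
analyticity domain = the domain of (180), `𝓗(0) = 0` by `chartH179_zero`.  Remaining hypotheses as in §2 ((4.4)+(1.18) for the outer
`f` on the presented space, `hballW`, `hSH`, r08's leaves, the row sum, the presentation letters).
[cite: Balaban1987RG1, (4.3)–(4.5) pp.281–282] [cite: Balaban1985Variational, Prop. 9 (190) pp.308–309]
[cite: Balaban1984PropagatorsII, Lemma 2.1 (2.61) p.234] -/
theorem ineq45_presented_sectG (R : Regime 𝒢 0 W B₀ θ C₄ a₃ j a ε₄) (hWa : AnalyticOnNhd ℂ W {Y : 𝒴 | ‖Y‖ < a₃})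
    {Dm : 𝒴 → 𝒳} (H : 𝒳 →L[ℂ] 𝒴) (hTm : AnalyticOnNhd ℂ (fun Y : 𝒴 => Y - H (Dm Y)) {Y : 𝒴 | ‖Y‖ < ε₄ + a})
    (hTm0 : (0 : 𝒴) - H (Dm 0) = 0)
    {bB : BlockNorm g 𝒳} {bN : BlockNorm g 𝒴} {b3 : BlockNorm g 𝒵}
    (hN : ∀ (y : g.Site) (v : 𝒴), bN.loc y v ≤ ‖v‖) (hBloc : ∀ (y' : g.Site) (μ : 𝒳), bB.IsLoc y' μ → ‖μ‖ ≤ bB.loc y' μ)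
    (hBn : ∀ (y' : g.Site) (μ : 𝒳), bB.loc y' μ ≤ ‖μ‖)
    [CompleteSpace E₀] (ev : Xp → (𝒴 →L[ℂ] E₀)) {boxp : g.Site → Finset Xp} (Xbl : Set g.Site)
    (hev : ∀ (yb : g.Site) (v : 𝒴), ∀ x ∈ boxp yb, ‖ev x v‖ ≤ bN.loc yb v) (hcover : ∀ x : Xp, ∃ yb ∈ Xbl, x ∈ boxp yb)
    {δ₀ BG θW cΔ A₀ AH θD c σ τ : ℝ}
    (htri : Triangle254 g) (hd : ∀ a b : g.Site, 0 ≤ g.dist a b) (hδ₀ : 0 ≤ δ₀) (hrow : RowSum g σ c) (hc : 0 ≤ c)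
    (hτ : 0 ≤ τ) (hστ : σ + τ ≤ δ₀ / 8)
    (hBG : 0 ≤ BG) (hθW : 0 ≤ θW) (hcΔ : 0 ≤ cΔ) (hA₀ : 0 ≤ A₀) (hAH : 0 ≤ AH) (hθD : 0 ≤ θD)
    (hG : HasMaj b3 bN (𝒢.restrictScalars ℝ : 𝒵 →ₗ[ℝ] 𝒴) (fun y y' => BG * Real.exp (-(δ₀ * g.dist y y'))))
    (hD2H0 : HasMaj bB b3 ((D2 ∘L H₀).restrictScalars ℝ : 𝒳 →ₗ[ℝ] 𝒵) (fun y y' => cΔ * Real.exp (-(δ₀ * g.dist y y'))))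
    (hH0 : HasMaj bB bN (H₀.restrictScalars ℝ : 𝒳 →ₗ[ℝ] 𝒴) (fun y y' => A₀ * Real.exp (-(δ₀ * g.dist y y'))))
    (hH : HasMaj bB bN (H.restrictScalars ℝ : 𝒳 →ₗ[ℝ] 𝒴) (fun y y' => AH * Real.exp (-(δ₀ / 2 * g.dist y y'))))
    (h189 : ∀ B' : 𝒳, ‖H₀ B'‖ < a → ‖D2 (H₀ B')‖ < j →
      Ineq189 bN b3 ((fderiv ℂ W (solA180 𝒢 W D2 H₀ ε₄ B' + H₀ B')).restrictScalars ℝ : 𝒴 →ₗ[ℝ] 𝒵) θW δ₀)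
    (hDfr : ∀ B' : 𝒳, ‖H₀ B'‖ < a → ‖D2 (H₀ B')‖ < j →
      ∃ 𝔇 : 𝒴 →L[ℂ] 𝒳, HasFDerivAt Dm 𝔇 (solA180 𝒢 W D2 H₀ ε₄ B' + H₀ B') ∧
        HasMaj bN bB (𝔇.restrictScalars ℝ : 𝒴 →ₗ[ℝ] 𝒳) (fun y y' => θD * Real.exp (-(δ₀ / 2 * g.dist y y'))))
    (hq : qG b3.κ bN.κ BG θW c < 1)
    {F : Type*} [NormedAddCommGroup F] [NormedSpace ℂ F] [CompleteSpace F]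
    {U : Set (Xp → E₀)} (hU : IsOpen U) {α₂ S : ℝ} (hα : 0 < α₂) (hballE : ball (0 : Xp → E₀) α₂ ⊆ U)
    {f : (Xp → E₀) → F} (hf : AnalyticOnNhd ℂ f U) (hS : ∀ y ∈ ball (0 : Xp → E₀) α₂, ‖f y‖ ≤ S)
    {aW SH : ℝ} (haW : 0 < aW) (hballW : ball (0 : 𝒳) aW ⊆ {B : 𝒳 | ‖H₀ B‖ < a ∧ ‖D2 (H₀ B)‖ < j})
    (hSH : ∀ y ∈ ball (0 : 𝒳) aW,
      ‖(fun x : Xp => ev x (chartH179 𝒢 W D2 H₀ (fun Y : 𝒴 => Y - H (Dm Y)) ε₄ y))‖ ≤ SH)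
    {n : ℕ} (B : Fin n → 𝒳) (out : Fin n → Prop) (i₀ : Fin n) (hi₀ : out i₀) {Dst : ℝ} (hDst : 0 ≤ Dst)
    (hlocB : ∀ i, out i → ∀ yb ∈ Xbl, ∀ y', bB.loc y' (B i) ≠ 0 → Dst ≤ g.dist yb y')
    (hBr : α₂ ≤ 2 * (max SH (const190 bB.κ bN.κ b3.κ BG θW cΔ A₀ AH θD c * bB.κ * c) * (max 1 (2 * (n : ℝ) / aW)) ^ n)) :
    ‖iteratedFDeriv ℂ n (f ∘ fun B' : 𝒳 => fun x : Xp => ev x (chartH179 𝒢 W D2 H₀ (fun Y : 𝒴 => Y - H (Dm Y)) ε₄ B')) 0 B‖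
      ≤ (2 * (n : ℝ) ^ 2 * (max SH (const190 bB.κ bN.κ b3.κ BG θW cΔ A₀ AH θD c * bB.κ * c)
            * (max 1 (2 * (n : ℝ) / aW)) ^ n) / α₂) ^ n * S * Real.exp (-(τ * Dst)) * ∏ i, ‖B i‖ := by
  have hUW : IsOpen {B : 𝒳 | ‖H₀ B‖ < a ∧ ‖D2 (H₀ B)‖ < j} := isOpen_dom180
  have h0dom : (0 : 𝒳) ∈ {B : 𝒳 | ‖H₀ B‖ < a ∧ ‖D2 (H₀ B)‖ < j} := hballW (mem_ball_self haW)
  have ha : 0 < a := by simpa using h0dom.1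
  have hj : 0 ≤ j := by have := h0dom.2; simp at this; exact this.le
  have hHan : AnalyticOnNhd ℂ
      (fun B' : 𝒳 => fun x : Xp => ev x (chartH179 𝒢 W D2 H₀ (fun Y : 𝒴 => Y - H (Dm Y)) ε₄ B'))
      {B : 𝒳 | ‖H₀ B‖ < a ∧ ‖D2 (H₀ B)‖ < j} := by
    intro B' hB'
    exact (ContinuousLinearMap.pi ev).analyticAt _ |>.comp ((analyticOnNhd_chartH179 R hWa hTm) B' hB')
  have hHp0 : (fun B' : 𝒳 => fun x : Xp => ev x (chartH179 𝒢 W D2 H₀ (fun Y : 𝒴 => Y - H (Dm Y)) ε₄ B')) 0 = 0 := by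
    funext x
    simp only [Pi.zero_apply]
    rw [chartH179_zero R hj ha hTm0, map_zero]
  have hK : 0 ≤ const190 bB.κ bN.κ b3.κ BG θW cΔ A₀ AH θD c * bB.κ * c :=
    mul_nonneg (mul_nonneg (const190_nonneg' bB.κ_nonneg bN.κ_nonneg b3.κ_nonneg hc hBG hθW hcΔ hA₀ hAH hθD hq)
      bB.κ_nonneg) hc
  have hW1 : Real.exp (-(τ * Dst)) ≤ 1 := Real.exp_le_one_iff.mpr (by nlinarith)
  have hloc : ∀ i, out i → ∀ y ∈ ball (0 : 𝒳) aW,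
      ‖fderiv ℂ (fun B' : 𝒳 => fun x : Xp => ev x (chartH179 𝒢 W D2 H₀ (fun Y : 𝒴 => Y - H (Dm Y)) ε₄ B')) y (B i)‖
        ≤ Real.exp (-(τ * Dst)) * (const190 bB.κ bN.κ b3.κ BG θW cΔ A₀ AH θD c * bB.κ * c * ‖B i‖) :=
    fun i hi y hy => norm_fderiv_presented_le_sectG R hWa H hTm hN hBloc hBn ev Xbl hev hcover htri hd hδ₀ hrow hc hτ hστ
      hBG hθW hcΔ hA₀ hAH hθD hG hD2H0 hH0 hH h189 hDfr hq (hballW hy) (B i) (hlocB i hi)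
  exact B12Eq45LocalisedBlocks.norm_iteratedFDeriv_comp_le_of_loc hU hα hballE hf hS hUW haW hballW hHan hSH hHp0 B
    (Real.exp_nonneg _) hW1 hK out i₀ hi₀ hloc hBr

end Literature.MathematicalPhysics.QuantumFieldTheory.Balaban1983to89.B12KernelBound422From190

end
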